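import Mathlib
import Summits.NavierStokesRegularity.NavierStokesRegularity.Theses.EulerZoomLiouville
import Summits.NavierStokesRegularity.NavierStokesRegularity.Theorems.EulerZoomLiouvillePowerGaugeEulerLiouvilleLargeRho
import Summits.NavierStokesRegularity.NavierStokesRegularity.Theorems.EulerZoomLiouvillePowerGaugeEulerLiouvillePastSymmetric
import Literature.Analysis.FluidPDE.ChaeEulerLiouville
import Literature.Analysis.FluidPDE.SuitableWeak
import HarnessLib.Audit

/-!
# Line `pressure-floor` (ideator ns-idea-11 g2, lens «complete» = program-completion) for the crux
# `EulerZoomLiouville.PowerGaugeEulerLiouville` (stmt-NavierStokesRegularity-19832)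

PROGRAMME COMPLETED.  Two programmes meet here.
(1) Seregin–Šverák, *Navier–Stokes equations with lower bounds on the pressure*, ARMA 163 (2002) 65–86, Thm 2.2 (p. 70;
    tree: `Literature/Analysis/FluidPDE/SereginSverak2002PressureLowerBound.lean`, cite-only acq-01580): a Navier–Stokes
    solution obeying ONE of the one-sided conditions `p ≥ −g` or `|u|² + 2p ≤ g` (normalised Bernoulli head bounded above)
    does not blow up — of any type.  Under Seregin's Type II Euler zoom (`u^λ = λ^α u(λ·, λ^{1+α}·)`, `p^λ = λ^{2α} p`,
    `α ∈ (0,1)`; route `EulerZoomLiouville`, `SereginZoomReduction` proved) these conditions are transported to the ancient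
    Euler limit as the SCALE-INVARIANT sign conditions `p ≥ 0`, resp. `|u|² + 2p ≤ 0` (`λ^{2α} g → 0`; the constraint sets are
    convex and closed under the zoom's weak-`L^{3/2}` / strong-`L²_loc` convergence).  The programme never asked what the
    Euler side of the zoom does with them.
(2) Chae, *On the nonexistence of global weak solutions to the Euler equations* / the weighted Liouville theorems,
    arXiv:0811.4647 Thm 1.1–1.2 (pp. 3–5) and CMP 2011 = arXiv:0809.0743 Thm 1.1 (p. 3) (tree: the weighted virial identity
    `IsDistributionalNSSolutionOn.ae_integral_hessian_apply_add_integral_pressure_mul_laplacian_eq_zero` and the convex-weight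
    Liouville `…ae_slice_eq_zero_of_convex_weight` in `Literature/Analysis/FluidPDE/ChaeEulerLiouville.lean`): a sign of
    `∫ p ΔΦ` against a CONVEX weight forces triviality — but convexity on all of `ℝ³` makes `ΔΦ ≳ 1/|x|` non-integrable, so
    Chae needs `∫ |p| / |x| < ∞`-type hypotheses, which Seregin's class (pressure gauge `D`: `∫∫_{Q(a)} |p|^{3/2} ≤ c a^{2−2ρ}`,
    i.e. `∫∫_{Q(a)} |p| ≲ a^{3 − 4ρ/3}`, GROWING) does not supply.  Chae's theorems therefore say nothing about the crux class.

THE LEVER (new on this crux; absent from `birth` v35, `rungC_window`, and the g0 lines `swirlfree_ledger`, `logtime_breathers`,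
`vortex_volume`, none of which uses the pressure's SIGN):  a NEWTONIAN BUMP WEIGHT `Ψ_R = Δ⁻¹ w_R`, the Newtonian potential of
the compactly supported radial density `w_R(x) = (1+|x|²)^{−β/2} θ(|x|/R)`, `β ∈ (1−2ρ, 1)`.  Its Laplacian is COMPACTLY
SUPPORTED and NON-NEGATIVE (so `∫ p ΔΨ_R` needs only `p ∈ L¹_loc`, which the `D`-gauge gives, and has a sign as soon as `p`
has a relative sign), while its Hessian is PINCHED on `B_R`,
  `((1−β)/(3−β)) w(x) |v|² ≤ D²Ψ_R(x)(v,v) ≤ (1/(3−β)) w(x) |v|²`   (`w = (1+|x|²)^{−β/2}`; shell-mean lemma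
  `F(r)/(r³ w(r)) ∈ [1/3, 1/(3−β)]` for the decreasing profile `w`, `F(r) = ∫₀ʳ s² w`),
and TIDALLY SMALL outside, `|D²Ψ_R(x)(v,v)| ≤ C_β R^{3−β} |x|^{−3} |v|²` — against the `A`-gauge (`∫_{B(a)} |u(t)|² ≤ c a^{1−2ρ}`)
the exterior contributes `O(R^{1−β−2ρ}) → 0` exactly because `β > 1−2ρ`, while `β < 1` keeps the interior coefficient positive.
The slicewise weighted virial identity `∫ D²Ψ_R(u(t),u(t)) dx + ∫ p(t) w_R dx = 0` (a.e. `t`; the tree's Chae identity applied on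
finite past windows — its six integrability hypotheses follow from the `A`- and `D`-gauges by dyadic summation since `Ψ_R`,
`∇Ψ_R`, `D²Ψ_R` decay like `|x|^{−1}, |x|^{−2}, |x|^{−3}`) then KILLS, for every `ρ` in the open window `0 < ρ ≤ 1/2`:
  (D) the PRESSURE-DEFICIT stratum `p ≥ −ε |u|²` a.e. with `ε < ε_*(ρ) := ρ/(1+ρ)` (contains `p ≥ 0`, the zoom image of the
      Seregin–Šverák floor, for every `ρ`), letting `β ↓ 1−2ρ` in `(1−β)/(3−β)`;
  (X) the PRESSURE-EXCESS stratum `p ≤ −κ |u|²` a.e. with `κ > κ_*(ρ) := 1/(2+2ρ)` (contains the non-positive Bernoulli head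
      `|u|² + 2p ≤ 0`, `κ = 1/2`, for every `ρ`), letting `β ↓ 1−2ρ` in `1/(3−β)`.
At the endpoint `ρ = 1/2` both thresholds equal `1/3`, the virial mean (`∫ (|u|² + 3p) = 0` for finite-energy slices): the
line then kills every member whose pressure ratio `p/|u|²` stays on one side of `−1/3`.  What it leaves — the PRESSURE-BALANCED
residue, members whose pressure crosses both relative levels in every neighbourhood of infinity — is the honest open rest
(`stub_balancedRest`), containing the lead's three open stubs minus the two strata; it is NOT claimed.
STRUCTURAL COROLLARY for the lead (free): any non-trivial member of the window class has `p + ε|u|² < 0` AND `p + κ|u|² > 0` on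
sets of positive measure, for all `ε < ρ/(1+ρ)`, `κ > 1/(2+2ρ)`.
DISTANCE LABEL (critic idea-crit-8 V17, P1 — carried verbatim wherever this line is advertised as «programme completed»): on the
NS side the `ε = 0` / `κ = 1/2` strata are zoom images of the Seregin–Šverák 2002 classes, which SS02 Thm 2.2 already makes regular
WITHOUT any zoom (no blow-up of any type); the line's new reach is exactly: the RELATIVE thresholds `0 < ε < ρ/(1+ρ)`,
`1/(2+2ρ) < κ < 1/2` inside the Type-II zoom scenario, the Euler-class strata (D), (X) usable by LEAD ns-typeII-p2's partition, and
the free corollary (every non-trivial window member is pressure-balanced: `p + ε|u|² < 0` and `p + κ|u|² > 0` on positive-measure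
sets); A5 = the crux minus two thin strata, ZERO prover width; the SS02 transport itself is docstring-only (not typed).
STAFFING (critic P2): ONE prover, sequential A2 → A1 → A3 → A4 (A4 mirrors A3 and reuses its exterior lemma); zero width on A5.
The composition `PowerGaugeEulerLiouville_of` is kernel-checked (no sorry of its own); sorries live only in `stub_*`.
The gradient gauge `E` is not used by this line.  No summit is proved by a line.
-/

open MeasureTheory Set Filter Topology Metric
open scoped ENNReal NNReal Laplacian ContDiff
open Literature.Analysis Literature.Analysis.FluidPDE

set_option linter.dupNamespace false

namespace Summit.NavierStokesRegularity.NavierStokesRegularity.Cruxes.PowerGaugeEulerLiouville.PressureFloor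

/-- Local abbreviation: ℝ³. -/
abbrev E3 : Type := EuclideanSpace ℝ (Fin 3)

/-- Membership in Seregin's power-gauged ancient Euler class — verbatim the three hypotheses of the crux (same as `Birth.InClass`). -/
@[reducible] def InClass (ρ : ℝ) (u : ℝ → E3 → E3) (p : ℝ → E3 → ℝ) (H : ℝ → E3 → E3 →L[ℝ] E3)
    (c : ℝ≥0) : Prop :=
  IsSuitableWeakSolutionOn (slab (EuclideanSpace ℝ (Fin 3)) (Set.Iio 0) isOpen_Iio) 0 0 u p ∧
    HasWeakSpatialGradientOn (slab (EuclideanSpace ℝ (Fin 3)) (Set.Iio 0) isOpen_Iio) u H ∧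
    (∀ a : ℝ, 0 < a →
      ENNReal.ofReal (a ^ (2 * ρ)) * cknA a (0 : ℝ × E3) u + ENNReal.ofReal (a ^ ρ) * cknE a (0 : ℝ × E3) H +
        ENNReal.ofReal (a ^ (2 * ρ)) * cknD a (0 : ℝ × E3) p ≤ (c : ℝ≥0∞))

/-- The conclusion of the crux: `u` vanishes a.e. on the past slab. -/
@[reducible] def VanishesAE (u : ℝ → E3 → E3) : Prop :=
  Function.uncurry u =ᵐ[volume.restrict (Set.Iio (0 : ℝ) ×ˢ (Set.univ : Set E3))] 0

/-- NEWTONIAN WEIGHTS: smooth `Φ : ℝ³ → ℝ` with the decay of a Newtonian potential of a compactly supported density —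
`|Φ| ≤ K/(1+|x|)`, `|∇Φ| ≤ K/(1+|x|)²`, `|D²Φ(x)(v,v)| ≤ K |v|²/(1+|x|)³`.  (These three rates are exactly what makes the six
integrability hypotheses of the tree's Chae identity summable against the `A`- and `D`-gauges on finite past windows.) -/
def IsNewtonianWeight (Φ : E3 → ℝ) : Prop :=
  ContDiff ℝ ∞ Φ ∧ ∃ K : ℝ, ∀ x : E3,
    |Φ x| ≤ K / (1 + ‖x‖) ∧ ‖fderiv ℝ Φ x‖ ≤ K / (1 + ‖x‖) ^ 2 ∧
      ∀ v : E3, |fderiv ℝ (fderiv ℝ Φ) x v v| ≤ K / (1 + ‖x‖) ^ 3 * ‖v‖ ^ 2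

/-- THE SLICEWISE WEIGHTED VIRIAL IDENTITY in the class: for every Newtonian weight `Φ` and almost every past time `t`,
both `x ↦ D²Φ(x)(u(t,x),u(t,x))` and `x ↦ p(t,x) ΔΦ(x)` are integrable over `ℝ³` and
`∫ D²Φ(x)(u(t,x),u(t,x)) dx + ∫ p(t,x) ΔΦ(x) dx = 0` (momentum flux tested against the gradient field `∇Φ`; the `∂ₜ` term dies
on gradients by incompressibility).  Integrability is part of the statement, so the Bochner integrals are not junk values. -/
def WeightedVirial (u : ℝ → E3 → E3) (p : ℝ → E3 → ℝ) : Prop :=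
  ∀ Φ : E3 → ℝ, IsNewtonianWeight Φ →
    ∀ᵐ t ∂(volume.restrict (Set.Iio (0 : ℝ))),
      Integrable (fun x : E3 => fderiv ℝ (fderiv ℝ Φ) x (u t x) (u t x)) ∧
        Integrable (fun x : E3 => p t x * Δ Φ x) ∧
          (∫ x, fderiv ℝ (fderiv ℝ Φ) x (u t x) (u t x)) + ∫ x, p t x * Δ Φ x = 0

/-- The radial power profile `w_β(x) = (1 + |x|²)^{−β/2}` (smooth, positive, radially non-increasing for `β ≥ 0`). -/
noncomputable def powerProfile (β : ℝ) (x : E3) : ℝ :=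
  (1 + ‖x‖ ^ 2) ^ (-(β / 2))

/-- THE NEWTONIAN BUMP FAMILY at exponent `β`: for every `R ≥ 1` a Newtonian weight `Ψ_R` whose Laplacian is a compactly
supported cut-off of the profile — `0 ≤ ΔΨ_R ≤ w_β`, `ΔΨ_R = w_β` on `B_R`, `ΔΨ_R = 0` off `B_{2R}` — whose Hessian is PINCHED on
`B_R`, `((1−β)/(3−β)) w_β |v|² ≤ D²Ψ_R(v,v) ≤ (1/(3−β)) w_β |v|²`, and TIDAL outside, `|D²Ψ_R(x)(v,v)| ≤ C R^{3−β} |x|^{−3} |v|²`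
for `|x| ≥ R`, with `C` depending on `β` only (radial Newtonian potential: `Ψ_R' = F/r²`, `F(r) = ∫₀ʳ s² ΔΨ_R`,
`D²Ψ_R = (ΔΨ_R − 2F/r³) ê_r⊗ê_r + (F/r³)(I − ê_r⊗ê_r)`, shell mean `F/(r³ w_β) ∈ [1/3, 1/(3−β)]` on `r ≤ R`, `F ≤ (2R)^{3−β}/(3−β)`). -/
def NewtonianBumpFamily (β : ℝ) : Prop :=
  ∃ C : ℝ, ∀ R : ℝ, 1 ≤ R → ∃ Ψ : E3 → ℝ, IsNewtonianWeight Ψ ∧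
    (∀ x : E3, 0 ≤ Δ Ψ x ∧ Δ Ψ x ≤ powerProfile β x) ∧
    (∀ x : E3, ‖x‖ ≤ R → Δ Ψ x = powerProfile β x) ∧
    (∀ x : E3, 2 * R ≤ ‖x‖ → Δ Ψ x = 0) ∧
    (∀ x : E3, ‖x‖ ≤ R → ∀ v : E3,
        (1 - β) / (3 - β) * powerProfile β x * ‖v‖ ^ 2 ≤ fderiv ℝ (fderiv ℝ Ψ) x v v ∧
          fderiv ℝ (fderiv ℝ Ψ) x v v ≤ 1 / (3 - β) * powerProfile β x * ‖v‖ ^ 2) ∧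
    (∀ x : E3, R ≤ ‖x‖ → ∀ v : E3, |fderiv ℝ (fderiv ℝ Ψ) x v v| ≤ C * R ^ (3 - β) / ‖x‖ ^ 3 * ‖v‖ ^ 2)

/-- THE PRESSURE-DEFICIT STRATUM (relative floor): `p ≥ −ε |u|²` a.e. on the past slab.  `ε = 0` is the zoom image of the
Seregin–Šverák floor `p ≥ −g`; `ε < 0` is a strict floor. -/
def PressureDeficit (ε : ℝ) (u : ℝ → E3 → E3) (p : ℝ → E3 → ℝ) : Prop :=
  ∀ᵐ z ∂(volume.restrict (Set.Iio (0 : ℝ) ×ˢ (Set.univ : Set E3))), -ε * ‖u z.1 z.2‖ ^ 2 ≤ p z.1 z.2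

/-- THE PRESSURE-EXCESS STRATUM (relative ceiling): `p ≤ −κ |u|²` a.e. on the past slab.  `κ = 1/2` is the zoom image of the
Seregin–Šverák head condition `|u|² + 2p ≤ g`. -/
def PressureExcess (κ : ℝ) (u : ℝ → E3 → E3) (p : ℝ → E3 → ℝ) : Prop :=
  ∀ᵐ z ∂(volume.restrict (Set.Iio (0 : ℝ) ×ˢ (Set.univ : Set E3))), p z.1 z.2 ≤ -κ * ‖u z.1 z.2‖ ^ 2

/-! ## Registered stub signatures -/

/-- Signature of `stub_weightedVirial` (A1, size M — GAUGE-TAIL SUMMATION): every member of the class satisfies the slicewise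
weighted virial identity for every Newtonian weight.  Route: restrict the distributional solution to the finite windows
`(−T, 0) × ℝ³` and feed the tree's
`IsDistributionalNSSolutionOn.ae_integral_hessian_apply_add_integral_pressure_mul_laplacian_eq_zero` with the tidal majorant
`w(x) = K (1+|x|)^{−3}`; its six integrability hypotheses are dyadic sums of the gauges: velocity terms
`Σ_k (2^k a₀)^{−3} · T · c (2^{k+1} a₀)^{1−2ρ} < ∞`, pressure terms (Hölder `∫∫_{Q(a)} |p| ≤ c' a^{3−4ρ/3}`)
`Σ_k (2^k a₀)^{−3} (2^{k+1} a₀)^{3−4ρ/3} < ∞` (`a₀² ≥ T`); slice integrability of the pressure term for a.e. `t` by Fubini.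
Exhaust `(−∞,0)` by `T = n`. -/
def Sig.stub_weightedVirial : Prop :=
  ∀ ρ : ℝ, 0 < ρ → ∀ (u : ℝ → E3 → E3) (p : ℝ → E3 → ℝ) (H : ℝ → E3 → E3 →L[ℝ] E3) (c : ℝ≥0),
    InClass ρ u p H c → WeightedVirial u p

/-- Signature of `stub_newtonianBumps` (A2, size M — RADIAL NEWTONIAN CALCULUS, pure real analysis, no fluid content): the
Newtonian bump family exists for every `β ∈ [0,1)`.  Route: `Ψ_R(x) = G_R(|x|²)` with `G_R` from the radial ODE
`Ψ'' + (2/r)Ψ' = w_R`, `Ψ'(r) = F(r)/r²`, normalised `Ψ(∞) = 0` (`Ψ = −M_R/r` off `B_{2R}`); smoothness at the origin because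
`w_R` is a smooth function of `|x|²`; the pinching constants come from the shell-mean lemma (`w_β` decreasing ⇒ `F ≥ r³w/3`;
`g = r³w/(3−β) − F` has `g' = r² w β (1 − r²/(1+r²)) /(3−β) ≥ 0` ⇒ `F ≤ r³ w/(3−β)`), the tidal constant from
`F(r) ≤ ∫₀^{2R} s^{2−β} ds` and `w_R ≤ R^{−β} ≤ 8 R^{3−β} |x|^{−3}` on the layer `R ≤ |x| ≤ 2R`. -/
def Sig.stub_newtonianBumps : Prop :=
  ∀ β : ℝ, 0 ≤ β → β < 1 → NewtonianBumpFamily β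

/-- Signature of `stub_deficitKill` (A3, size M — THE DEFICIT KILL, core of the line): in the window `0 < ρ ≤ 1/2`, a member with
the weighted virial identities and a relative pressure floor `p ≥ −ε|u|²`, `ε < ρ/(1+ρ)`, vanishes.  Route: pick
`β ∈ (1−2ρ, 1)` with `(1−β)/(3−β) > ε` (possible exactly because `ε < ρ/(1+ρ) = (1−β)/(3−β)|_{β=1−2ρ}`); for a.e. `t` and every
`R = n ≥ √(−t)`: `0 = ∫ D²Ψ_n(u,u) + ∫ p ΔΨ_n ≥ ((1−β)/(3−β) − ε⁺) ∫_{B_n} w_β |u(t)|² − C' c n^{1−β−2ρ}` (interior pinching, `ΔΨ_n ≥ 0`,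
exterior tidal bound summed dyadically against the `A`-gauge, layer term `ε⁺ n^{−β} c (2n)^{1−2ρ}`); let `n → ∞`: the monotone
limit `∫ w_β |u(t)|² = 0`, so `u(t) = 0` a.e.; conclude with Tonelli / `PastSymmetric.ae_eq_zero_of_gauge_of_pastSlicesZero`. -/
def Sig.stub_deficitKill : Prop :=
  ∀ ρ : ℝ, 0 < ρ → ρ ≤ 1 / 2 →
    ∀ (u : ℝ → E3 → E3) (p : ℝ → E3 → ℝ) (H : ℝ → E3 → E3 →L[ℝ] E3) (c : ℝ≥0),
      InClass ρ u p H c → WeightedVirial u p → (∀ β : ℝ, 0 ≤ β → β < 1 → NewtonianBumpFamily β) →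
        ∀ ε : ℝ, ε < ρ / (1 + ρ) → PressureDeficit ε u p → VanishesAE u

/-- Signature of `stub_excessKill` (A4, size M — THE EXCESS KILL, mirror image): in the window, a member with the weighted virial
identities and a relative pressure ceiling `p ≤ −κ|u|²`, `κ > 1/(2+2ρ)`, vanishes.  Route: pick `β ∈ (1−2ρ, 1)` with `1/(3−β) < κ`
(possible exactly because `κ > 1/(2+2ρ) = 1/(3−β)|_{β=1−2ρ}`); for a.e. `t`, `R = n`:
`0 = ∫ D²Ψ_n(u,u) + ∫ p ΔΨ_n ≤ (1/(3−β) − κ) ∫_{B_n} w_β |u(t)|² + C' c n^{1−β−2ρ}` (upper pinching inside, `−κ ΔΨ_n |u|² ≤ 0` dropped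
outside `B_n`, tidal bound summed against the `A`-gauge); `n → ∞` gives `u(t) = 0` a.e., then Tonelli. -/
def Sig.stub_excessKill : Prop :=
  ∀ ρ : ℝ, 0 < ρ → ρ ≤ 1 / 2 →
    ∀ (u : ℝ → E3 → E3) (p : ℝ → E3 → ℝ) (H : ℝ → E3 → E3 →L[ℝ] E3) (c : ℝ≥0),
      InClass ρ u p H c → WeightedVirial u p → (∀ β : ℝ, 0 ≤ β → β < 1 → NewtonianBumpFamily β) →
        ∀ κ : ℝ, 1 / (2 + 2 * ρ) < κ → PressureExcess κ u p → VanishesAE u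

/-- Signature of `stub_balancedRest` (A5, OPEN RESIDUE — crux-sized, NOT claimed): members of the window class that are
PRESSURE-BALANCED — no relative floor below `ρ/(1+ρ)` and no relative ceiling above `1/(2+2ρ)` holds a.e. — vanish.  This is the
honest remainder of the crux after the two sign strata; the lead's open stubs (`birth` v35) live here minus the strata. -/
def Sig.stub_balancedRest : Prop :=
  ∀ ρ : ℝ, 0 < ρ → ρ ≤ 1 / 2 →
    ∀ (u : ℝ → E3 → E3) (p : ℝ → E3 → ℝ) (H : ℝ → E3 → E3 →L[ℝ] E3) (c : ℝ≥0),
      InClass ρ u p H c →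
        (¬ ∃ ε : ℝ, ε < ρ / (1 + ρ) ∧ PressureDeficit ε u p) →
          (¬ ∃ κ : ℝ, 1 / (2 + 2 * ρ) < κ ∧ PressureExcess κ u p) → VanishesAE u

/-! ## Stubs (the ONLY sorries of this file) -/

theorem stub_weightedVirial : Sig.stub_weightedVirial := by
  sorry

theorem stub_newtonianBumps : Sig.stub_newtonianBumps := by
  sorry

theorem stub_deficitKill : Sig.stub_deficitKill := by
  sorry

theorem stub_excessKill : Sig.stub_excessKill := by
  sorry

theorem stub_balancedRest : Sig.stub_balancedRest := by
  sorry

/-! ## Checked bookkeeping (kernel-checked, no sorry): the Seregin–Šverák classes sit inside the killed strata for EVERY `ρ > 0`,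
and the two thresholds meet at the virial mean `1/3` at the endpoint `ρ = 1/2`. -/

/-- The zoom image `p ≥ 0` of the Seregin–Šverák floor is a deficit stratum with `ε = 0 < ρ/(1+ρ)`. -/
theorem floor_in_deficit_stratum {ρ : ℝ} (hρ : 0 < ρ) : (0 : ℝ) < ρ / (1 + ρ) := by
  positivity

/-- The zoom image `|u|² + 2p ≤ 0` of the Seregin–Šverák head condition is an excess stratum with `κ = 1/2 > 1/(2+2ρ)`. -/
theorem head_in_excess_stratum {ρ : ℝ} (hρ : 0 < ρ) : 1 / (2 + 2 * ρ) < (1 : ℝ) / 2 := by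
  rw [div_lt_div_iff_of_pos_left one_pos (by linarith) two_pos]
  linarith

/-- At the window endpoint `ρ = 1/2` both thresholds equal the virial mean `1/3`. -/
theorem thresholds_meet_at_endpoint :
    (1 / 2 : ℝ) / (1 + 1 / 2) = 1 / 3 ∧ (1 : ℝ) / (2 + 2 * (1 / 2)) = 1 / 3 := by
  norm_num

/-- `PressureDeficit 0` is literally `p ≥ 0` a.e. and `PressureExcess (1/2)` is literally `|u|² + 2p ≤ 0` a.e. -/
theorem deficit_zero_iff (u : ℝ → E3 → E3) (p : ℝ → E3 → ℝ) :
    PressureDeficit 0 u p ↔ ∀ᵐ z ∂(volume.restrict (Set.Iio (0 : ℝ) ×ˢ (Set.univ : Set E3))), 0 ≤ p z.1 z.2 := by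
  simp [PressureDeficit]

theorem excess_half_iff (u : ℝ → E3 → E3) (p : ℝ → E3 → ℝ) :
    PressureExcess (1 / 2) u p ↔
      ∀ᵐ z ∂(volume.restrict (Set.Iio (0 : ℝ) ×ˢ (Set.univ : Set E3))), ‖u z.1 z.2‖ ^ 2 + 2 * p z.1 z.2 ≤ 0 := by
  simp only [PressureExcess]
  constructor <;> intro h <;> filter_upwards [h] with z hz <;> linarith

/-- THE DEFICIT EXPONENT CHOICE (used inside A3): for `ε < ρ/(1+ρ)`, `0 < ρ ≤ 1/2`, an admissible `β ∈ [0,1) ∩ (1−2ρ,1)` with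
interior pinching constant `(1−β)/(3−β) > ε` exists (`β = (1−3m)/(1−m)` with `m` the midpoint of `ε` and `ρ/(1+ρ)` makes `(1−β)/(3−β) = m`). -/
theorem exists_beta_deficit {ρ ε : ℝ} (hρ : 0 < ρ) (hρ2 : ρ ≤ 1 / 2) (hε : ε < ρ / (1 + ρ)) :
    ∃ β : ℝ, 0 ≤ β ∧ β < 1 ∧ 1 - 2 * ρ < β ∧ ε < (1 - β) / (3 - β) := by
  have hq : 0 < ρ / (1 + ρ) := by positivity
  have hq3 : ρ / (1 + ρ) ≤ 1 / 3 := by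
    rw [div_le_div_iff₀ (by linarith) (by norm_num)]
    linarith
  by_cases hε0 : ε ≤ 0
  · refine ⟨1 - ρ, by linarith, by linarith, by linarith, ?_⟩
    have : (0 : ℝ) < (1 - (1 - ρ)) / (3 - (1 - ρ)) := div_pos (by linarith) (by linarith)
    linarith
  · push_neg at hε0
    set m : ℝ := (ε + ρ / (1 + ρ)) / 2 with hm
    have hmε : ε < m := by rw [hm]; linarith
    have hmq : m < ρ / (1 + ρ) := by rw [hm]; linarith
    have hm0 : 0 < m := by linarith
    have hm3 : m < 1 / 3 := by linarith
    have h1m : 0 < 1 - m := by linarith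
    refine ⟨(1 - 3 * m) / (1 - m), div_nonneg (by linarith) h1m.le, ?_, ?_, ?_⟩
    · rw [div_lt_one h1m]
      linarith
    · rw [lt_div_iff₀ h1m]
      have h' : m * (1 + ρ) < ρ := by
        have := hmq
        rwa [lt_div_iff₀ (by linarith)] at this
      nlinarith
    · have hβ1 : 1 - (1 - 3 * m) / (1 - m) = 2 * m / (1 - m) := by
        field_simp
        ring
      have hβ3 : 3 - (1 - 3 * m) / (1 - m) = 2 / (1 - m) := by
        field_simp
        ring
      rw [hβ1, hβ3, div_div_div_cancel_right₀ (ne_of_gt h1m)]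
      linarith

/-- THE EXCESS EXPONENT CHOICE (used inside A4): for `κ > 1/(2+2ρ)`, `0 < ρ ≤ 1/2`, an admissible `β ∈ [0,1) ∩ (1−2ρ,1)` with
upper pinching constant `1/(3−β) < κ` exists (`β = 3 − 1/m` with `m` the midpoint of `1/(2+2ρ)` and `min κ ½` makes `1/(3−β) = m`). -/
theorem exists_beta_excess {ρ κ : ℝ} (hρ : 0 < ρ) (hρ2 : ρ ≤ 1 / 2) (hκ : 1 / (2 + 2 * ρ) < κ) :
    ∃ β : ℝ, 0 ≤ β ∧ β < 1 ∧ 1 - 2 * ρ < β ∧ 1 / (3 - β) < κ := by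
  -- target value m := midpoint of 1/(2+2ρ) and min κ (1/2); β := 3 - 1/m
  have hq : (0 : ℝ) < 1 / (2 + 2 * ρ) := by positivity
  have hq3 : (1 : ℝ) / 3 ≤ 1 / (2 + 2 * ρ) := by
    rw [div_le_div_iff₀ (by norm_num) (by linarith)]
    linarith
  set κ' : ℝ := min κ (1 / 2) with hκ'
  have hκ'κ : κ' ≤ κ := min_le_left _ _
  have hκ'h : κ' ≤ 1 / 2 := min_le_right _ _
  have hqκ' : 1 / (2 + 2 * ρ) < κ' := by
    rw [hκ']
    refine lt_min hκ ?_
    rw [div_lt_div_iff₀ (by linarith) (by norm_num)]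
    linarith
  set m : ℝ := (1 / (2 + 2 * ρ) + κ') / 2 with hm
  have hmq : 1 / (2 + 2 * ρ) < m := by rw [hm]; linarith
  have hmκ : m < κ' := by rw [hm]; linarith
  have hm0 : 0 < m := by linarith
  have hm3 : 1 / 3 < m := by linarith
  have hmh : m < 1 / 2 := by linarith
  refine ⟨3 - 1 / m, ?_, ?_, ?_, ?_⟩
  · have : 1 / m ≤ 3 := by
      rw [div_le_iff₀ hm0]
      linarith
    linarith
  · have : 2 < 1 / m := by
      rw [lt_div_iff₀ hm0]
      linarith
    linarith
  · -- 1 - 2ρ < 3 - 1/m ⟺ 1/m < 2 + 2ρ ⟺ 1 < m (2+2ρ)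
    have h' : 1 < m * (2 + 2 * ρ) := by
      have := hmq
      rwa [div_lt_iff₀ (by linarith)] at this
    have : 1 / m < 2 + 2 * ρ := by
      rw [div_lt_iff₀ hm0]
      linarith
    linarith
  · have : 3 - (3 - 1 / m) = 1 / m := by ring
    rw [this, one_div_one_div]
    linarith

/-! ## Composition -/

/-- **Composition (kernel-checked, no sorry of its own): the five stubs give the crux BY NAME.**  Case split: `ρ > 1/2` is the
landed `powerGaugeEulerLiouville_largeRho`; in the window, a member in a deficit stratum dies by A1+A2+A3, a member in an excess
stratum by A1+A2+A4, and the pressure-balanced rest is A5. -/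
theorem PowerGaugeEulerLiouville_of :
    Sig.stub_weightedVirial → Sig.stub_newtonianBumps → Sig.stub_deficitKill → Sig.stub_excessKill →
      Sig.stub_balancedRest →
        Summit.NavierStokesRegularity.NavierStokesRegularity.Theses.EulerZoomLiouville.PowerGaugeEulerLiouville := by
  intro h1 h2 h3 h4 h5 ρ hρ u p H c hsw hH hc
  by_cases hhalf : 1 / 2 < ρ
  · exact
      Summit.NavierStokesRegularity.NavierStokesRegularity.Theorems.PowerGaugeEulerLiouville.powerGaugeEulerLiouville_largeRho
        ρ hhalf u p H c hsw hH hc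
  · have hρ2 : ρ ≤ 1 / 2 := not_lt.mp hhalf
    by_cases hD : ∃ ε : ℝ, ε < ρ / (1 + ρ) ∧ PressureDeficit ε u p
    · obtain ⟨ε, hε, hd⟩ := hD
      exact h3 ρ hρ hρ2 u p H c ⟨hsw, hH, hc⟩ (h1 ρ hρ u p H c ⟨hsw, hH, hc⟩) h2 ε hε hd
    · by_cases hX : ∃ κ : ℝ, 1 / (2 + 2 * ρ) < κ ∧ PressureExcess κ u p
      · obtain ⟨κ, hκ, hx⟩ := hX
        exact h4 ρ hρ hρ2 u p H c ⟨hsw, hH, hc⟩ (h1 ρ hρ u p H c ⟨hsw, hH, hc⟩) h2 κ hκ hx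
      · exact h5 ρ hρ hρ2 u p H c ⟨hsw, hH, hc⟩ hD hX

end Summit.NavierStokesRegularity.NavierStokesRegularity.Cruxes.PowerGaugeEulerLiouville.PressureFloor
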